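import Summits.BirchSwinnertonDyer.BirchSwinnertonDyer.Theorems.ByReductionTypeAtTwoFineSelmerConjAAtTwoAdditivePotGoodTwoLayerStampsEvenIndexA
import Summits.BirchSwinnertonDyer.BirchSwinnertonDyer.Theorems.ByReductionTypeAtTwoFineSelmerConjAAtTwoAdditivePotGoodTwoLayerStampsEvenIndexB
import Summits.BirchSwinnertonDyer.BirchSwinnertonDyer.Theorems.ByReductionTypeAtTwoFineSelmerConjAAtTwoAdditivePotGoodTwoLayerStampsUnramifiedTwo
import Summits.BirchSwinnertonDyer.BirchSwinnertonDyer.Theorems.ByReductionTypeAtTwoFineSelmerConjAAtTwoAdditivePotGoodClassNumberOne6453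
import Summits.BirchSwinnertonDyer.BirchSwinnertonDyer.Theorems.ByReductionTypeAtTwoFineSelmerConjAAtTwoAdditivePotGoodChevalleyOneBitDoor
import HarnessLib

/-!
# Census rows with NO displayed bit: the one-bit rows closed by Chevalley's door at `p = 2`

Sub-problem `BirchSwinnertonDyer`, route `ByReductionTypeAtTwo`, item `FineSelmerConjAAtTwoAdditivePotGood` (C1″), helper file
(census currency).  Rows: `237952bv1`, `261648q1`, `244416cn1`, `434964b1`, `293200be1`, `412992bw1`.  Each former one-bit stamp `conjA_two_<L>_of_layerOneBit hLim2 hθ h1`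
displayed `h1 : ∀ κL cyclotomic over ℚ(θ), e₁(κL) = 0` (`2 ∤ h(ℚ(θ, √2))`); here `h1` is DISCHARGED by
`layerOneBit_of_chevalleyCert` (file `…ChevalleyOneBitDoor`): Chevalley's ambiguous class number formula for `ℚ(θ,√2)/ℚ(θ)`
with a unit of `ℚ(θ)` whose `2`-adic image is `≡ ±3 (mod 8)` (not a norm), `2 ∤ h(ℚ(θ))` (kernel certificate already in the
tree) and at most two primes above `2` (two `4 ∤ g` witnesses).  Result: `conjA_two_<L> hLim2 hθ κ hκ` — the row is conditional on
`hLim2` ALONE, like the Fukuda / unique-prime rows.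

## What this does NOT prove
`hLim2` (Lim 2017, Thm. 3.5 at `p = 2`) remains an input in print; Conjecture A itself and BSD are not advanced by these stamps.
-/

set_option autoImplicit false
set_option linter.dupNamespace false

noncomputable section

open scoped Classical IntermediateField NumberField Real nonZeroDivisors

namespace Summit.BirchSwinnertonDyer.BirchSwinnertonDyer.Theorems.AddKatoTwo

open WeierstrassCurve Field Polynomial IsDedekindDomain NumberField Matrix Literature.NumberTheory.EllipticCurves
  Literature.NumberTheory.IwasawaTheory

/-- **Row `237952bv1` — NO displayed bit left (`hLim2` ALONE).**  `K = ℚ(θ)`, `θ³ + 0θ² − 1θ − 2 = 0`: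
the former displayed bit `e₁ = 0` (`2 ∤ h(K(√2))`) is DECIDED by Chevalley's door at `p = 2` with the certificate
unit `ε = (-1 + -1θ + 1θ²)/1` (`ε³ + (1)ε² + (5)ε + (1) = 0`), Hensel datum `a = 6` (`8 ∣ g(6)`, `g'(6)` odd) and
`ε ≡ 5 (mod 8)` under `θ ↦ z ≡ 6`: `(ε, 2)₂ = −1`; at most two primes above `2` by `4 ∤ g(0)`, `4 ∤ g(1)`.
Remaining input: `hLim2` (Lim's Theorem 3.5 at `p = 2`, in print).  BSD is not advanced by this stamp. -/
theorem conjA_two_237952bv1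
    (hLim2 : Lim2017.thm35_at_two_fineSelmerDual_moduleFinite_of_classicalMuVanishes_of_le_divisionField_four)
    {θ : AlgebraicClosure ℚ} (hθ : aeval θ (Cubic.toPoly ⟨1, ((0 : ℤ) : ℚ), ((-1 : ℤ) : ℚ), ((-2 : ℤ) : ℚ)⟩) = 0)
    (κ : ZpExtension ℚ 2) (hκ : κ.IsCyclotomic) :
    haveI := isElliptic_237952bv1'
    ∃ (γ : absoluteGaloisGroup ℚ) (D : (⟨0, ((0 : ℤ) : ℚ), 0, ((-947226241 : ℤ) : ℚ), ((-11222597935198 : ℤ) : ℚ)⟩ : WeierstrassCurve ℚ).FineSelmerDualData κ γ),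
      Module.Finite ℤ_[2] (RestrictScalars ℤ_[2] (IwasawaAlgebra 2) D.X) := by
  haveI := isElliptic_237952bv1'
  have hθ' : θ ^ 3 + (0 : AlgebraicClosure ℚ) * θ ^ 2 + (-1 : AlgebraicClosure ℚ) * θ + (-2 : AlgebraicClosure ℚ) = 0 := by
    have := hθ
    simp only [Cubic.toPoly, map_one, one_mul, aeval_add, aeval_mul, aeval_C, aeval_X_pow, aeval_X,
      eq_ratCast, Rat.cast_intCast] at this
    push_cast at this
    linear_combination this
  have he : aeval (algebraMap ℚ (AlgebraicClosure ℚ) (((-1 : ℤ) : ℚ) / ((1 : ℤ) : ℚ)) +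
      algebraMap ℚ (AlgebraicClosure ℚ) (((-1 : ℤ) : ℚ) / ((1 : ℤ) : ℚ)) * θ +
      algebraMap ℚ (AlgebraicClosure ℚ) (((1 : ℤ) : ℚ) / ((1 : ℤ) : ℚ)) * θ ^ 2)
      (Cubic.toPoly ⟨1, ((1 : ℤ) : ℚ), ((5 : ℤ) : ℚ), ((1 : ℤ) : ℚ)⟩) = 0 := by
    simp only [Cubic.toPoly, map_one, one_mul, aeval_add, aeval_mul, aeval_C, aeval_X_pow, aeval_X, eq_ratCast,
      Rat.cast_intCast, Rat.cast_div]
    push_cast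
    linear_combination ((2 : AlgebraicClosure ℚ) + (2 : AlgebraicClosure ℚ) * θ + (-3 : AlgebraicClosure ℚ) * θ ^ 2 + (1 : AlgebraicClosure ℚ) * θ ^ 3) * hθ'
  exact conjA_two_237952bv1_of_layerOneBit hLim2 hθ
    (layerOneBit_of_chevalleyCert irreducible_cubic_d104n hθ (by rw [card_classGroup_adjoin_eq_one_disc_neg104 hθ]; norm_num) ⟨0, by norm_num⟩ ⟨0, by norm_num⟩
      (-1) (-1) (1) (1) (1) (5) (1) (by norm_num) he (6) (1) (by norm_num) (by norm_num) (by decide) (by decide)) κ hκ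

/-- **Row `261648q1` — NO displayed bit left (`hLim2` ALONE).**  `K = ℚ(θ)`, `θ³ − 1θ² − 4θ + 2 = 0`:
the former displayed bit `e₁ = 0` (`2 ∤ h(K(√2))`) is DECIDED by Chevalley's door at `p = 2` with the certificate
unit `ε = (3 + 1θ + -1θ²)/1` (`ε³ + (-1)ε² + (-7)ε + (-1) = 0`), Hensel datum `a = 3` (`8 ∣ g(3)`, `g'(3)` odd) and
`ε ≡ 5 (mod 8)` under `θ ↦ z ≡ 3`: `(ε, 2)₂ = −1`; at most two primes above `2` by `4 ∤ g(0)`, `4 ∤ g(1)`.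
Remaining input: `hLim2` (Lim's Theorem 3.5 at `p = 2`, in print).  BSD is not advanced by this stamp. -/
theorem conjA_two_261648q1
    (hLim2 : Lim2017.thm35_at_two_fineSelmerDual_moduleFinite_of_classicalMuVanishes_of_le_divisionField_four)
    {θ : AlgebraicClosure ℚ} (hθ : aeval θ (Cubic.toPoly ⟨1, ((-1 : ℤ) : ℚ), ((-4 : ℤ) : ℚ), ((2 : ℤ) : ℚ)⟩) = 0)
    (κ : ZpExtension ℚ 2) (hκ : κ.IsCyclotomic) :
    haveI := isElliptic_261648q1'
    ∃ (γ : absoluteGaloisGroup ℚ) (D : (⟨0, ((0 : ℤ) : ℚ), 0, ((-3540805887 : ℤ) : ℚ), ((-81096346959158 : ℤ) : ℚ)⟩ : WeierstrassCurve ℚ).FineSelmerDualData κ γ),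
      Module.Finite ℤ_[2] (RestrictScalars ℤ_[2] (IwasawaAlgebra 2) D.X) := by
  haveI := isElliptic_261648q1'
  have hθ' : θ ^ 3 + (-1 : AlgebraicClosure ℚ) * θ ^ 2 + (-4 : AlgebraicClosure ℚ) * θ + (2 : AlgebraicClosure ℚ) = 0 := by
    have := hθ
    simp only [Cubic.toPoly, map_one, one_mul, aeval_add, aeval_mul, aeval_C, aeval_X_pow, aeval_X,
      eq_ratCast, Rat.cast_intCast] at this
    push_cast at this
    linear_combination this
  have he : aeval (algebraMap ℚ (AlgebraicClosure ℚ) (((3 : ℤ) : ℚ) / ((1 : ℤ) : ℚ)) +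
      algebraMap ℚ (AlgebraicClosure ℚ) (((1 : ℤ) : ℚ) / ((1 : ℤ) : ℚ)) * θ +
      algebraMap ℚ (AlgebraicClosure ℚ) (((-1 : ℤ) : ℚ) / ((1 : ℤ) : ℚ)) * θ ^ 2)
      (Cubic.toPoly ⟨1, ((-1 : ℤ) : ℚ), ((-7 : ℤ) : ℚ), ((-1 : ℤ) : ℚ)⟩) = 0 := by
    simp only [Cubic.toPoly, map_one, one_mul, aeval_add, aeval_mul, aeval_C, aeval_X_pow, aeval_X, eq_ratCast,
      Rat.cast_intCast, Rat.cast_div]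
    push_cast
    linear_combination ((-2 : AlgebraicClosure ℚ) + (3 : AlgebraicClosure ℚ) * θ + (2 : AlgebraicClosure ℚ) * θ ^ 2 + (-1 : AlgebraicClosure ℚ) * θ ^ 3) * hθ'
  exact conjA_two_261648q1_of_layerOneBit hLim2 hθ
    (layerOneBit_of_chevalleyCert irreducible_cubic_d316p hθ (by rw [card_classGroup_adjoin_eq_one_disc_316 hθ]; norm_num) ⟨0, by norm_num⟩ ⟨0, by norm_num⟩
      (3) (1) (-1) (1) (-1) (-7) (-1) (by norm_num) he (3) (1) (by norm_num) (by norm_num) (by decide) (by decide)) κ hκ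

/-- **Row `244416cn1` — NO displayed bit left (`hLim2` ALONE).**  `K = ℚ(θ)`, `θ³ − 1θ² + 4θ − 6 = 0`:
the former displayed bit `e₁ = 0` (`2 ∤ h(K(√2))`) is DECIDED by Chevalley's door at `p = 2` with the certificate
unit `ε = (19 + 2θ + -12θ²)/1` (`ε³ + (-143)ε² + (5279)ε + (-1) = 0`), Hensel datum `a = 3` (`8 ∣ g(3)`, `g'(3)` odd) and
`ε ≡ 5 (mod 8)` under `θ ↦ z ≡ 3`: `(ε, 2)₂ = −1`; at most two primes above `2` by `4 ∤ g(0)`, `4 ∤ g(1)`.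
Remaining input: `hLim2` (Lim's Theorem 3.5 at `p = 2`, in print).  BSD is not advanced by this stamp. -/
theorem conjA_two_244416cn1
    (hLim2 : Lim2017.thm35_at_two_fineSelmerDual_moduleFinite_of_classicalMuVanishes_of_le_divisionField_four)
    {θ : AlgebraicClosure ℚ} (hθ : aeval θ (Cubic.toPoly ⟨1, ((-1 : ℤ) : ℚ), ((4 : ℤ) : ℚ), ((-6 : ℤ) : ℚ)⟩) = 0)
    (κ : ZpExtension ℚ 2) (hκ : κ.IsCyclotomic) :
    haveI := isElliptic_244416cn1'
    ∃ (γ : absoluteGaloisGroup ℚ) (D : (⟨0, ((1 : ℤ) : ℚ), 0, ((-4424231585 : ℤ) : ℚ), ((-113268864408513 : ℤ) : ℚ)⟩ : WeierstrassCurve ℚ).FineSelmerDualData κ γ),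
      Module.Finite ℤ_[2] (RestrictScalars ℤ_[2] (IwasawaAlgebra 2) D.X) := by
  haveI := isElliptic_244416cn1'
  have hθ' : θ ^ 3 + (-1 : AlgebraicClosure ℚ) * θ ^ 2 + (4 : AlgebraicClosure ℚ) * θ + (-6 : AlgebraicClosure ℚ) = 0 := by
    have := hθ
    simp only [Cubic.toPoly, map_one, one_mul, aeval_add, aeval_mul, aeval_C, aeval_X_pow, aeval_X,
      eq_ratCast, Rat.cast_intCast] at this
    push_cast at this
    linear_combination this
  have he : aeval (algebraMap ℚ (AlgebraicClosure ℚ) (((19 : ℤ) : ℚ) / ((1 : ℤ) : ℚ)) +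
      algebraMap ℚ (AlgebraicClosure ℚ) (((2 : ℤ) : ℚ) / ((1 : ℤ) : ℚ)) * θ +
      algebraMap ℚ (AlgebraicClosure ℚ) (((-12 : ℤ) : ℚ) / ((1 : ℤ) : ℚ)) * θ ^ 2)
      (Cubic.toPoly ⟨1, ((-143 : ℤ) : ℚ), ((5279 : ℤ) : ℚ), ((-1 : ℤ) : ℚ)⟩) = 0 := by
    simp only [Cubic.toPoly, map_one, one_mul, aeval_add, aeval_mul, aeval_C, aeval_X_pow, aeval_X, eq_ratCast,
      Rat.cast_intCast, Rat.cast_div]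
    push_cast
    linear_combination ((-9256 : AlgebraicClosure ℚ) + (-6480 : AlgebraicClosure ℚ) * θ + (-864 : AlgebraicClosure ℚ) * θ ^ 2 + (-1728 : AlgebraicClosure ℚ) * θ ^ 3) * hθ'
  exact conjA_two_244416cn1_of_layerOneBit hLim2 hθ
    (layerOneBit_of_chevalleyCert irreducible_cubic_d804n hθ (by rw [card_classGroup_adjoin_eq_one_disc_neg804 hθ]; norm_num) ⟨0, by norm_num⟩ ⟨0, by norm_num⟩
      (19) (2) (-12) (1) (-143) (5279) (-1) (by norm_num) he (3) (1) (by norm_num) (by norm_num) (by decide) (by decide)) κ hκ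

/-- **Row `434964b1` — NO displayed bit left (`hLim2` ALONE).**  `K = ℚ(θ)`, `θ³ − 1θ² + 4θ − 6 = 0`:
the former displayed bit `e₁ = 0` (`2 ∤ h(K(√2))`) is DECIDED by Chevalley's door at `p = 2` with the certificate
unit `ε = (19 + 2θ + -12θ²)/1` (`ε³ + (-143)ε² + (5279)ε + (-1) = 0`), Hensel datum `a = 3` (`8 ∣ g(3)`, `g'(3)` odd) and
`ε ≡ 5 (mod 8)` under `θ ↦ z ≡ 3`: `(ε, 2)₂ = −1`; at most two primes above `2` by `4 ∤ g(0)`, `4 ∤ g(1)`.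
Remaining input: `hLim2` (Lim's Theorem 3.5 at `p = 2`, in print).  BSD is not advanced by this stamp. -/
theorem conjA_two_434964b1
    (hLim2 : Lim2017.thm35_at_two_fineSelmerDual_moduleFinite_of_classicalMuVanishes_of_le_divisionField_four)
    {θ : AlgebraicClosure ℚ} (hθ : aeval θ (Cubic.toPoly ⟨1, ((-1 : ℤ) : ℚ), ((4 : ℤ) : ℚ), ((-6 : ℤ) : ℚ)⟩) = 0)
    (κ : ZpExtension ℚ 2) (hκ : κ.IsCyclotomic) :
    haveI := isElliptic_434964b1'
    ∃ (γ : absoluteGaloisGroup ℚ) (D : (⟨0, ((-1 : ℤ) : ℚ), 0, ((-23349300 : ℤ) : ℚ), ((-43419126312 : ℤ) : ℚ)⟩ : WeierstrassCurve ℚ).FineSelmerDualData κ γ),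
      Module.Finite ℤ_[2] (RestrictScalars ℤ_[2] (IwasawaAlgebra 2) D.X) := by
  haveI := isElliptic_434964b1'
  have hθ' : θ ^ 3 + (-1 : AlgebraicClosure ℚ) * θ ^ 2 + (4 : AlgebraicClosure ℚ) * θ + (-6 : AlgebraicClosure ℚ) = 0 := by
    have := hθ
    simp only [Cubic.toPoly, map_one, one_mul, aeval_add, aeval_mul, aeval_C, aeval_X_pow, aeval_X,
      eq_ratCast, Rat.cast_intCast] at this
    push_cast at this
    linear_combination this
  have he : aeval (algebraMap ℚ (AlgebraicClosure ℚ) (((19 : ℤ) : ℚ) / ((1 : ℤ) : ℚ)) +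
      algebraMap ℚ (AlgebraicClosure ℚ) (((2 : ℤ) : ℚ) / ((1 : ℤ) : ℚ)) * θ +
      algebraMap ℚ (AlgebraicClosure ℚ) (((-12 : ℤ) : ℚ) / ((1 : ℤ) : ℚ)) * θ ^ 2)
      (Cubic.toPoly ⟨1, ((-143 : ℤ) : ℚ), ((5279 : ℤ) : ℚ), ((-1 : ℤ) : ℚ)⟩) = 0 := by
    simp only [Cubic.toPoly, map_one, one_mul, aeval_add, aeval_mul, aeval_C, aeval_X_pow, aeval_X, eq_ratCast,
      Rat.cast_intCast, Rat.cast_div]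
    push_cast
    linear_combination ((-9256 : AlgebraicClosure ℚ) + (-6480 : AlgebraicClosure ℚ) * θ + (-864 : AlgebraicClosure ℚ) * θ ^ 2 + (-1728 : AlgebraicClosure ℚ) * θ ^ 3) * hθ'
  exact conjA_two_434964b1_of_layerOneBit hLim2 hθ
    (layerOneBit_of_chevalleyCert irreducible_cubic_d804n hθ (by rw [card_classGroup_adjoin_eq_one_disc_neg804 hθ]; norm_num) ⟨0, by norm_num⟩ ⟨0, by norm_num⟩
      (19) (2) (-12) (1) (-143) (5279) (-1) (by norm_num) he (3) (1) (by norm_num) (by norm_num) (by decide) (by decide)) κ hκ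

/-- **Row `293200be1` — NO displayed bit left (`hLim2` ALONE).**  `K = ℚ(θ)`, `θ³ − 1θ² − 7θ + 8 = 0`:
the former displayed bit `e₁ = 0` (`2 ∤ h(K(√2))`) is DECIDED by Chevalley's door at `p = 2` with the certificate
unit `ε = (5 + -2θ + 0θ²)/1` (`ε³ + (-13)ε² + (27)ε + (1) = 0`), Hensel datum `a = 0` (`8 ∣ g(0)`, `g'(0)` odd) and
`ε ≡ 5 (mod 8)` under `θ ↦ z ≡ 0`: `(ε, 2)₂ = −1`; at most two primes above `2` by `4 ∤ g(2)`, `4 ∤ g(1)`.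
Remaining input: `hLim2` (Lim's Theorem 3.5 at `p = 2`, in print).  BSD is not advanced by this stamp. -/
theorem conjA_two_293200be1
    (hLim2 : Lim2017.thm35_at_two_fineSelmerDual_moduleFinite_of_classicalMuVanishes_of_le_divisionField_four)
    {θ : AlgebraicClosure ℚ} (hθ : aeval θ (Cubic.toPoly ⟨1, ((-1 : ℤ) : ℚ), ((-7 : ℤ) : ℚ), ((8 : ℤ) : ℚ)⟩) = 0)
    (κ : ZpExtension ℚ 2) (hκ : κ.IsCyclotomic) :
    haveI := isElliptic_293200be1'
    ∃ (γ : absoluteGaloisGroup ℚ) (D : (⟨0, ((1 : ℤ) : ℚ), 0, ((-3388217033 : ℤ) : ℚ), ((-75912170159062 : ℤ) : ℚ)⟩ :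
        WeierstrassCurve ℚ).FineSelmerDualData κ γ),
      Module.Finite ℤ_[2] (RestrictScalars ℤ_[2] (IwasawaAlgebra 2) D.X) := by
  haveI := isElliptic_293200be1'
  have hθ' : θ ^ 3 + (-1 : AlgebraicClosure ℚ) * θ ^ 2 + (-7 : AlgebraicClosure ℚ) * θ + (8 : AlgebraicClosure ℚ) = 0 := by
    have := hθ
    simp only [Cubic.toPoly, map_one, one_mul, aeval_add, aeval_mul, aeval_C, aeval_X_pow, aeval_X,
      eq_ratCast, Rat.cast_intCast] at this
    push_cast at this
    linear_combination this
  have he : aeval (algebraMap ℚ (AlgebraicClosure ℚ) (((5 : ℤ) : ℚ) / ((1 : ℤ) : ℚ)) +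
      algebraMap ℚ (AlgebraicClosure ℚ) (((-2 : ℤ) : ℚ) / ((1 : ℤ) : ℚ)) * θ +
      algebraMap ℚ (AlgebraicClosure ℚ) (((0 : ℤ) : ℚ) / ((1 : ℤ) : ℚ)) * θ ^ 2)
      (Cubic.toPoly ⟨1, ((-13 : ℤ) : ℚ), ((27 : ℤ) : ℚ), ((1 : ℤ) : ℚ)⟩) = 0 := by
    simp only [Cubic.toPoly, map_one, one_mul, aeval_add, aeval_mul, aeval_C, aeval_X_pow, aeval_X, eq_ratCast,
      Rat.cast_intCast, Rat.cast_div]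
    push_cast
    linear_combination ((-8 : AlgebraicClosure ℚ) + (0 : AlgebraicClosure ℚ) * θ + (0 : AlgebraicClosure ℚ) * θ ^ 2 + (0 : AlgebraicClosure ℚ) * θ ^ 3) * hθ'
  exact conjA_two_293200be1_of_layerOneBit hLim2 hθ
    (layerOneBit_of_chevalleyCert irreducible_cubic_disc_733 hθ (by rw [card_classGroup_adjoin_eq_one_disc_733 hθ]; norm_num) ⟨1, by norm_num⟩ ⟨0, by norm_num⟩
      (5) (-2) (0) (1) (-13) (27) (1) (by norm_num) he (0) (1) (by norm_num) (by norm_num) (by decide) (by decide)) κ hκ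

/-- **Row `412992bw1` — NO displayed bit left (`hLim2` ALONE).**  `K = ℚ(θ)`, `θ³ + 0θ² − 18θ − 25 = 0`:
the former displayed bit `e₁ = 0` (`2 ∤ h(K(√2))`) is DECIDED by Chevalley's door at `p = 2` with the certificate
unit `ε = (-11 + -10θ + -2θ²)/1` (`ε³ + (105)ε² + (-57)ε + (-1) = 0`), Hensel datum `a = 7` (`8 ∣ g(7)`, `g'(7)` odd) and
`ε ≡ 5 (mod 8)` under `θ ↦ z ≡ 7`: `(ε, 2)₂ = −1`; at most two primes above `2` by `4 ∤ g(0)`, `4 ∤ g(1)`.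
Remaining input: `hLim2` (Lim's Theorem 3.5 at `p = 2`, in print).  BSD is not advanced by this stamp. -/
theorem conjA_two_412992bw1
    (hLim2 : Lim2017.thm35_at_two_fineSelmerDual_moduleFinite_of_classicalMuVanishes_of_le_divisionField_four)
    {θ : AlgebraicClosure ℚ} (hθ : aeval θ (Cubic.toPoly ⟨1, ((0 : ℤ) : ℚ), ((-18 : ℤ) : ℚ), ((-25 : ℤ) : ℚ)⟩) = 0)
    (κ : ZpExtension ℚ 2) (hκ : κ.IsCyclotomic) :
    haveI := isElliptic_412992bw1'
    ∃ (γ : absoluteGaloisGroup ℚ) (D : (⟨0, ((0 : ℤ) : ℚ), 0, ((-43798121268 : ℤ) : ℚ), ((-3528022418672640 : ℤ) : ℚ)⟩ :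
        WeierstrassCurve ℚ).FineSelmerDualData κ γ),
      Module.Finite ℤ_[2] (RestrictScalars ℤ_[2] (IwasawaAlgebra 2) D.X) := by
  haveI := isElliptic_412992bw1'
  have hθ' : θ ^ 3 + (0 : AlgebraicClosure ℚ) * θ ^ 2 + (-18 : AlgebraicClosure ℚ) * θ + (-25 : AlgebraicClosure ℚ) = 0 := by
    have := hθ
    simp only [Cubic.toPoly, map_one, one_mul, aeval_add, aeval_mul, aeval_C, aeval_X_pow, aeval_X,
      eq_ratCast, Rat.cast_intCast] at this
    push_cast at this
    linear_combination this
  have he : aeval (algebraMap ℚ (AlgebraicClosure ℚ) (((-11 : ℤ) : ℚ) / ((1 : ℤ) : ℚ)) +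
      algebraMap ℚ (AlgebraicClosure ℚ) (((-10 : ℤ) : ℚ) / ((1 : ℤ) : ℚ)) * θ +
      algebraMap ℚ (AlgebraicClosure ℚ) (((-2 : ℤ) : ℚ) / ((1 : ℤ) : ℚ)) * θ ^ 2)
      (Cubic.toPoly ⟨1, ((105 : ℤ) : ℚ), ((-57 : ℤ) : ℚ), ((-1 : ℤ) : ℚ)⟩) = 0 := by
    simp only [Cubic.toPoly, map_one, one_mul, aeval_add, aeval_mul, aeval_C, aeval_X_pow, aeval_X, eq_ratCast,
      Rat.cast_intCast, Rat.cast_div]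
    push_cast
    linear_combination ((-480 : AlgebraicClosure ℚ) + (-456 : AlgebraicClosure ℚ) * θ + (-120 : AlgebraicClosure ℚ) * θ ^ 2 + (-8 : AlgebraicClosure ℚ) * θ ^ 3) * hθ'
  exact conjA_two_412992bw1_of_layerOneBit hLim2 hθ
    (layerOneBit_of_chevalleyCert irreducible_cubic_disc_6453 hθ (by rw [card_classGroup_adjoin_eq_one_disc_6453 hθ]; norm_num) ⟨0, by norm_num⟩ ⟨0, by norm_num⟩
      (-11) (-10) (-2) (1) (105) (-57) (-1) (by norm_num) he (7) (1) (by norm_num) (by norm_num) (by decide) (by decide)) κ hκ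

end Summit.BirchSwinnertonDyer.BirchSwinnertonDyer.Theorems.AddKatoTwo

end
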